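import Literature.MathematicalPhysics.QuantumFieldTheory.Balaban1983to89.B6Geom246MultiLevelTorus

/-!
# `Balaban1983to89.B6TorusSiteWalks` — T. Bałaban, *Propagators and renormalization transformations for lattice gauge
# theories. II*, Commun. Math. Phys. **96** (1984) 223–250 [Balaban1984PropagatorsII], (2.1)–(2.2) p. 224 and (2.45)–(2.46)
# p. 231, read for S. Agmon's positive-weight method [Agmon1982]: **LATTICE WALKS ON THE SITES OF THE TORUS `T_η`, THEIR
# MULTI-SCALE WEIGHTED LENGTH, AND THE LEVEL BAND LEMMA** (file 1 of 2 of the site-level Agmon exponent of the block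
# distance (2.46); seat `pub-ymgap-dag-n06-j`, the geometric junction named by width seat `pub-ymgap-dag-n06-w1`)

statement-level skeleton of published theorems with citation tags; proofs where landed; nothing here is a claim about the Yang–Mills mass gap

THE PRINT.  [B6] p. 224 (2.1)–(2.2): a nested family `Ω₁ ⊃ Ω₂ ⊃ … ⊃ Ω_k` of the torus with
`(Lʲη)⁻¹ dist(Ω_j^c, Ω_{j+1}) > RM`; p. 231 (2.45)–(2.46): the blocks `𝔅 = ⋃_j Λ_j` and the contour distance `d(y,y′)`
(number of admissible bonds).  [B9] (T. Bałaban, Commun. Math. Phys. **99** (1985), p. 397): the decay of the propagators is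
measured in «the weighted distance d(y,y′) defined by (2.36) in [4]», lengths in units of the local block scale.

WHY THIS FILE.  The width seat `dag-n06-w1` typed [B9] Thm 3.1 (3.46) for def-Y's `G′(U)` by Agmon's method for an
ABSTRACT site exponent `ρ` with two Lipschitz properties — `|ρ(z+e_μ) − ρ z| ≤ (L^{lev})⁻¹` at both ends of every
lattice bond and oscillation `≤ D` on every block of `𝔅` (`B9Thm31SiteAgmonWeightY`) — and left «ONE geometric lemma» to a
successor: such a `ρ` dominating print's block distance (2.46).  This file and its sibling `B6AgmonExponentMultiLevelTorus`
supply it at the [B6] layer (generic `D : TDomains`).  Here: the lattice graph of the torus box, the weighted length of a walk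
with the step weight `L^{−max(lev z, lev z′)}` (the largest weight obeying both bond caps), and the two inputs of the
domination argument that use (2.2) only: adjacent sites differ in level by `≤ 1`, and ★ THE BAND LEMMA — a walk meeting a
site of level `≤ i − 1` and a site of level `≥ i + 1` has weighted length `≥ R·M_h∕2` (the sites are `> R·M_h·L^{i+1}`
apart in the torus sup-distance by `TDomains.sepT`, and every step costs at least `L^{−(i+1)}` times the change of the
torus distance to `Ω_{i+1}`).

WHAT IS PROVED (sorry-free; nothing of [B6]∕[B9] asserted beyond what is proved).
* §1 `latRel`, `latGraphT N` (sites of the box `Π_μ[0,N_μ)` joined by the unit torus translations), `torusSupNorm_sub_self`,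
  `torusSupNorm_sub_comm`, `torusSupNorm_sub_triangle`, `exists_int_torusSupNorm` (the torus sup-distance is an integer),
  `torusSupNorm_le_one_of_adj`, ★ `torusSupNorm_le_length` (a walk is at least as long as the torus distance of its ends),
  `latGraphT_reachable` (the lattice graph is connected: a staircase to the origin).
* §2 `stepWt D z z′ = (L^{max(lev z, lev z′)})⁻¹`, `stepWt_comm ∕ _pos ∕ _le_left ∕ _le_right ∕ _ge_of_le`, the weighted
  length `wtLen D p` of a walk (`wtLen_nil ∕ _cons ∕ _nonneg ∕ _append`), ★ `length_le_mul_wtLen` (all levels on the walk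
  `≤ J` ⇒ `length ≤ L^J · wtLen`).
* §3 `lev_le_succ_of_torusSupNorm_le_one` ((2.2) ⇒ adjacent levels differ by `≤ 1`), the potential `highDistT D i`
  (torus distance to `Ω_{i+1} = {lev ≥ i+1}`): `_nonneg`, `_eq_zero`, `_sub_le`, ★ `le_highDistT_of_lev_lt` ((2.2):
  `≥ R·M_h·L^{i+1}` at sites of level `≤ i−1`), `stepWt_ge_highDistT` (one step pays `L^{−(i+1)}` per unit change of the
  potential), `highDistT_var_le_wtLen`, ★★ `wtLen_ge_of_spread` (THE BAND LEMMA).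
HONEST SCOPE.  Elementary lattice geometry of [B6]'s nested torus family; no operator, no estimate of [B9]; NOT a node
discharge; count-neutral; nothing continuum ∕ OS ∕ mass gap ∕ Clay.  NEW file importing `B6Geom246MultiLevelTorus` only;
nothing landed is modified.  Net new unproved facts: 0.
-/

namespace Literature.MathematicalPhysics.QuantumFieldTheory.Balaban1983to89.B6TorusSiteWalks

open Literature.MathematicalPhysics.QuantumFieldTheory.Balaban1983to89.B4Reflection242 (boxDom mem_boxDom blk)
open Literature.MathematicalPhysics.QuantumFieldTheory.Balaban1983to89.B4TorusKernel.MultiPeriod (circAbs circAbs_nonneg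
  circAbs_le_abs circAbs_add_mul abs_add_mul_centre centre torusSupNorm translate torusSupNorm_le_supNorm
  torusSupNorm_translate torusSupNorm_nonneg translate_apply)
open Literature.MathematicalPhysics.QuantumFieldTheory.Balaban1983to89.B4ContourShift (supNorm abs_le_supNorm supNorm_nonneg)
open Literature.MathematicalPhysics.QuantumFieldTheory.Balaban1983to89.B6MultiLevelBoxOperator
open Literature.MathematicalPhysics.QuantumFieldTheory.Balaban1983to89.B6Geom246MultiLevelBox
open Literature.MathematicalPhysics.QuantumFieldTheory.Balaban1983to89.B6MultiLevelTorusOperator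
open Literature.MathematicalPhysics.QuantumFieldTheory.Balaban1983to89.B6Geom246MultiLevelTorus

noncomputable section

variable {d : ℕ}

/-! ## §1 The lattice graph of the torus box and the torus sup-distance along walks -/

section Lattice

variable (N : Fin (d + 1) → ℕ)

/-- **THE LATTICE BONDS OF THE TORUS** `T = Π_μ ℤ∕N_μℤ` on its fundamental box: `y` is the unit torus translate `σ_{e_μ} x`
of `x` for some direction `μ` (the lattice bonds `⟨z, z + e_μ⟩` with periodic conditions).
[cite: Balaban1984PropagatorsII, (2.1) p.224 («Ω₁ = T_η»); Balaban1983RegularityDecay, p.572 (periodic conditions), dictionary] -/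
def latRel (x y : ↥(boxDom N)) : Prop := ∃ μ : Fin (d + 1), y = tshift N (unitVec μ) x

/-- **THE LATTICE GRAPH OF THE TORUS** (the symmetrised relation `latRel` on distinct sites).
[cite: Balaban1984PropagatorsII, (2.1) p.224 («Ω₁ = T_η»); Balaban1983RegularityDecay, p.572 (periodic conditions), dictionary] -/
def latGraphT : SimpleGraph ↥(boxDom N) := SimpleGraph.fromRel (latRel N)

variable {N}

/-- adjacency in the lattice graph: distinct, and one is a unit torus translate of the other. [cite: Balaban1983RegularityDecay, p.572 (periodic conditions), dictionary] -/
theorem latGraphT_adj {x y : ↥(boxDom N)} :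
    (latGraphT N).Adj x y ↔ x ≠ y ∧ ((∃ μ : Fin (d + 1), y = tshift N (unitVec μ) x) ∨ ∃ μ : Fin (d + 1), x = tshift N (unitVec μ) y) := by
  rw [latGraphT, SimpleGraph.fromRel_adj]; rfl

/-- `|x − x|_T = 0`. [cite: Balaban1984PropagatorsII, (2.54) p.233, bookkeeping] -/
theorem torusSupNorm_sub_self (hN : ∀ i, 1 ≤ N i) (x : Fin (d + 1) → ℤ) : torusSupNorm N (x - x) = 0 := by
  rw [← dist_toT_toR hN, dist_self]

/-- `|x − y|_T = |y − x|_T`. [cite: Balaban1984PropagatorsII, (2.54) p.233, bookkeeping] -/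
theorem torusSupNorm_sub_comm (hN : ∀ i, 1 ≤ N i) (x y : Fin (d + 1) → ℤ) :
    torusSupNorm N (x - y) = torusSupNorm N (y - x) := by
  rw [← dist_toT_toR hN, ← dist_toT_toR hN, dist_comm]

/-- the triangle inequality of the torus sup-distance. [cite: Balaban1984PropagatorsII, (2.54) p.233, dictionary] -/
theorem torusSupNorm_sub_triangle (hN : ∀ i, 1 ≤ N i) (x y z : Fin (d + 1) → ℤ) :
    torusSupNorm N (x - z) ≤ torusSupNorm N (x - y) + torusSupNorm N (y - z) := by
  rw [← dist_toT_toR hN, ← dist_toT_toR hN, ← dist_toT_toR hN]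
  exact dist_triangle _ _ _

/-- the torus sup-distance of an integer vector is an integer (the sup is attained). [cite: Balaban1983RegularityDecay, p.572 (periodic conditions), bookkeeping] -/
theorem exists_int_torusSupNorm (x : Fin (d + 1) → ℤ) : ∃ n : ℤ, torusSupNorm N x = n := by
  obtain ⟨i, _, h⟩ := Finset.exists_mem_eq_sup' Finset.univ_nonempty (fun i => ((circAbs (N i) (x i) : ℤ) : ℝ))
  exact ⟨circAbs (N i) (x i), h⟩

/-- each torus coordinate distance is at most the torus sup-distance. [cite: Balaban1983RegularityDecay, p.572 (periodic conditions), bookkeeping] -/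
theorem circAbs_le_torusSupNorm (x : Fin (d + 1) → ℤ) (μ : Fin (d + 1)) :
    ((circAbs (N μ) (x μ) : ℤ) : ℝ) ≤ torusSupNorm N x :=
  Finset.le_sup' (fun i => ((circAbs (N i) (x i) : ℤ) : ℝ)) (Finset.mem_univ μ)

/-- a unit torus translation moves a site by torus distance `≤ 1`: `|σ_{e_μ} z − z|_T ≤ 1`.
[cite: Balaban1983RegularityDecay, p.572 (periodic conditions), dictionary] -/
theorem torusSupNorm_tshift_unitVec_sub_le (hN : ∀ i, 1 ≤ N i) (μ : Fin (d + 1)) (z : ↥(boxDom N)) :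
    torusSupNorm N ((tshift N (unitVec μ) z).1 - z.1) ≤ 1 := by
  obtain ⟨m, hm⟩ := tshift_val_eq_translate N (unitVec μ) z
  have e : (tshift N (unitVec μ) z).1 - z.1 = translate N (unitVec μ) m := by
    rw [hm]
    funext i
    simp only [Pi.sub_apply, translate_apply, Pi.add_apply]
    ring
  rw [e, torusSupNorm_translate]
  refine (torusSupNorm_le_supNorm hN _).trans (Finset.sup'_le _ _ fun i _ => ?_)
  by_cases hi : i = μ
  · subst hi
    rw [unitVec, Pi.single_eq_same]
    norm_num
  · rw [unitVec, Pi.single_eq_of_ne hi, abs_zero]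
    norm_num

/-- adjacent sites of the lattice graph are at torus distance `≤ 1`. [cite: Balaban1983RegularityDecay, p.572, dictionary] -/
theorem torusSupNorm_le_one_of_adj (hN : ∀ i, 1 ≤ N i) {x y : ↥(boxDom N)} (h : (latGraphT N).Adj x y) :
    torusSupNorm N (x.1 - y.1) ≤ 1 := by
  obtain ⟨_, ⟨μ, h⟩ | ⟨μ, h⟩⟩ := latGraphT_adj.1 h
  · rw [torusSupNorm_sub_comm hN, h]
    exact torusSupNorm_tshift_unitVec_sub_le hN μ x
  · rw [h]
    exact torusSupNorm_tshift_unitVec_sub_le hN μ y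

/-- ★ **A LATTICE WALK IS AT LEAST AS LONG AS THE TORUS DISTANCE OF ITS ENDS**: `|x − y|_T ≤ |p|`.
[cite: Balaban1984PropagatorsII, p.231–232 (d versus the lattice distance), dictionary] -/
theorem torusSupNorm_le_length (hN : ∀ i, 1 ≤ N i) {x y : ↥(boxDom N)} (p : (latGraphT N).Walk x y) :
    torusSupNorm N (x.1 - y.1) ≤ p.length := by
  induction p with
  | nil => rw [torusSupNorm_sub_self hN]; simp
  | @cons u v w h p ih =>
      rw [SimpleGraph.Walk.length_cons, Nat.cast_add, Nat.cast_one]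
      calc torusSupNorm N (u.1 - w.1) ≤ torusSupNorm N (u.1 - v.1) + torusSupNorm N (v.1 - w.1) :=
            torusSupNorm_sub_triangle hN _ _ _
        _ ≤ 1 + p.length := add_le_add (torusSupNorm_le_one_of_adj hN h) ih
        _ = p.length + 1 := add_comm _ _

/-- lowering one positive coordinate of a box site gives a box site whose unit translate is the original site. [cite: Balaban1983RegularityDecay, p.572 (periodic conditions), bookkeeping] -/
theorem tshift_pred_eq {x : ↥(boxDom N)} {μ : Fin (d + 1)} (hμ : 1 ≤ x.1 μ) :
    ∃ x' : ↥(boxDom N), x'.1 = x.1 - unitVec μ ∧ tshift N (unitVec μ) x' = x := by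
  have hx := mem_boxDom.1 x.2
  have hmem : x.1 - unitVec μ ∈ boxDom N := by
    rw [mem_boxDom]
    intro i
    by_cases hi : i = μ
    · subst hi
      simp only [Pi.sub_apply, unitVec, Pi.single_eq_same]
      exact ⟨by omega, by linarith [(hx i).2]⟩
    · simp only [Pi.sub_apply, unitVec, Pi.single_eq_of_ne hi, sub_zero]
      exact hx i
  refine ⟨⟨x.1 - unitVec μ, hmem⟩, rfl, ?_⟩
  apply Subtype.ext
  have hmem' : (⟨x.1 - unitVec μ, hmem⟩ : ↥(boxDom N)).1 + unitVec μ ∈ boxDom N := by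
    rw [sub_add_cancel]; exact x.2
  rw [tshift_val_of_mem hmem', sub_add_cancel]

/-- **THE LATTICE GRAPH OF THE TORUS BOX IS CONNECTED**: every site is joined to the origin by a coordinate staircase.
[cite: Balaban1983RegularityDecay, p.572, dictionary] -/
theorem latGraphT_reachable (hN : ∀ i, 1 ≤ N i) (x y : ↥(boxDom N)) : (latGraphT N).Reachable x y := by
  -- the origin
  have h0 : (fun _ => (0 : ℤ)) ∈ boxDom N := mem_boxDom.2 fun i => ⟨le_rfl, by exact_mod_cast hN i⟩
  -- every site reaches the origin, by induction on the sum of its coordinates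
  have key : ∀ (n : ℕ) (z : ↥(boxDom N)), (∑ i, (z.1 i).toNat) = n → (latGraphT N).Reachable z ⟨_, h0⟩ := by
    intro n
    induction n with
    | zero =>
        intro z hz
        have hz0 : ∀ i, z.1 i = 0 := by
          intro i
          have h1 := (mem_boxDom.1 z.2 i).1
          have h2 : (z.1 i).toNat = 0 := (Finset.sum_eq_zero_iff.1 hz) i (Finset.mem_univ i)
          omega
        have : z = ⟨_, h0⟩ := Subtype.ext (funext hz0)
        rw [this]
    | succ n ih =>
        intro z hz
        -- some coordinate is positive
        have hex : ∃ μ, 1 ≤ z.1 μ := by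
          by_contra hcon
          push Not at hcon
          have : (∑ i, (z.1 i).toNat) = 0 := Finset.sum_eq_zero fun i _ => by
            have := hcon i; omega
          omega
        obtain ⟨μ, hμ⟩ := hex
        obtain ⟨z', hz'v, hz's⟩ := tshift_pred_eq (N := N) hμ
        have hsum : (∑ i, (z'.1 i).toNat) = n := by
          have hsplit : (∑ i, (z.1 i).toNat) = (∑ i, (z'.1 i).toNat) + 1 := by
            have e : ∀ i, (z.1 i).toNat = (z'.1 i).toNat + (if i = μ then 1 else 0) := by
              intro i
              rw [hz'v]
              by_cases hi : i = μ
              · subst hi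
                simp only [Pi.sub_apply, unitVec, Pi.single_eq_same, if_true]
                omega
              · simp only [Pi.sub_apply, unitVec, Pi.single_eq_of_ne hi, sub_zero, if_neg hi, add_zero]
            simp only [e, Finset.sum_add_distrib, Finset.sum_ite_eq', Finset.mem_univ, if_true]
          omega
        have hreach := ih z' hsum
        by_cases hzz : z = z'
        · rw [hzz]; exact hreach
        · have hadj : (latGraphT N).Adj z z' := latGraphT_adj.2 ⟨hzz, Or.inr ⟨μ, hz's.symm⟩⟩
          exact hadj.reachable.trans hreach
  exact (key _ x rfl).trans (key _ y rfl).symm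

end Lattice

/-! ## §2 The multi-scale step weight and the weighted length of a walk -/

section Weight

variable {ℓ Mh k R : ℕ} {P : Fin (d + 1) → ℕ} (D : TDomains d ℓ Mh k P R)

/-- **THE STEP WEIGHT** `w(z, z′) = L^{−max(lev z, lev z′)}` — the largest weight obeying both bond caps `(L^{lev z})⁻¹`,
`(L^{lev z′})⁻¹` of the Agmon exponent (print: a step inside `Ω_j∖Ω_{j+1}` has length `(Lʲη)⁻¹·η`).
[cite: Balaban1984PropagatorsII, (2.46) p.231; Balaban1985BackgroundPropagators, p.397 (weighted distance); Agmon1982, Ch.1] -/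
def stepWt (z z' : ↥(boxDom (N0 ℓ Mh k P))) : ℝ :=
  ((((ℓ + 1) ^ max (D.lev z.1) (D.lev z'.1) : ℕ) : ℝ))⁻¹

/-- the step weight is symmetric. [cite: Balaban1984PropagatorsII, (2.46) p.231, bookkeeping] -/
theorem stepWt_comm (z z' : ↥(boxDom (N0 ℓ Mh k P))) : stepWt D z z' = stepWt D z' z := by
  unfold stepWt; rw [max_comm]

/-- the step weight is positive. [cite: Balaban1984PropagatorsII, (2.46) p.231, bookkeeping] -/
theorem stepWt_pos (z z' : ↥(boxDom (N0 ℓ Mh k P))) : 0 < stepWt D z z' := by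
  unfold stepWt; positivity

/-- powers of `L` are monotone (real cast). [cite: Balaban1984PropagatorsII, (2.1) p.224, bookkeeping] -/
private theorem powL_mono {a b : ℕ} (h : a ≤ b) : (((ℓ + 1) ^ a : ℕ) : ℝ) ≤ (((ℓ + 1) ^ b : ℕ) : ℝ) := by
  exact_mod_cast Nat.pow_le_pow_right (by omega) h

/-- the step weight obeys the cap at the first end: `w(z,z′) ≤ (L^{lev z})⁻¹`. [cite: Agmon1982, Ch.1; Balaban1985BackgroundPropagators, p.397] -/
theorem stepWt_le_left (z z' : ↥(boxDom (N0 ℓ Mh k P))) :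
    stepWt D z z' ≤ ((((ℓ + 1) ^ D.lev z.1 : ℕ) : ℝ))⁻¹ :=
  inv_anti₀ (by positivity) (powL_mono (le_max_left _ _))

/-- the step weight obeys the cap at the second end: `w(z,z′) ≤ (L^{lev z′})⁻¹`. [cite: Agmon1982, Ch.1; Balaban1985BackgroundPropagators, p.397] -/
theorem stepWt_le_right (z z' : ↥(boxDom (N0 ℓ Mh k P))) :
    stepWt D z z' ≤ ((((ℓ + 1) ^ D.lev z'.1 : ℕ) : ℝ))⁻¹ :=
  inv_anti₀ (by positivity) (powL_mono (le_max_right _ _))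

/-- below level `J` a step costs at least `(L^J)⁻¹`. [cite: Balaban1984PropagatorsII, (2.46) p.231, dictionary] -/
theorem stepWt_ge_of_le {J : ℕ} {z z' : ↥(boxDom (N0 ℓ Mh k P))} (hz : D.lev z.1 ≤ J) (hz' : D.lev z'.1 ≤ J) :
    ((((ℓ + 1) ^ J : ℕ) : ℝ))⁻¹ ≤ stepWt D z z' :=
  inv_anti₀ (by positivity) (powL_mono (max_le hz hz'))

/-- **THE WEIGHTED LENGTH OF A LATTICE WALK**: the sum of the step weights. [cite: Balaban1985BackgroundPropagators, p.397 (weighted distance); Agmon1982, Ch.1] -/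
def wtLen : ∀ {x y : ↥(boxDom (N0 ℓ Mh k P))}, (latGraphT (N0 ℓ Mh k P)).Walk x y → ℝ
  | _, _, SimpleGraph.Walk.nil => 0
  | x, _, SimpleGraph.Walk.cons (v := y) _ p => stepWt D x y + wtLen p

/-- the trivial walk has weighted length `0`. [cite: Balaban1985BackgroundPropagators, p.397 (weighted distance), bookkeeping] -/
@[simp] theorem wtLen_nil (x : ↥(boxDom (N0 ℓ Mh k P))) :
    wtLen D (SimpleGraph.Walk.nil : (latGraphT (N0 ℓ Mh k P)).Walk x x) = 0 := rfl

/-- weighted length of a walk with a first step. [cite: Balaban1985BackgroundPropagators, p.397 (weighted distance), bookkeeping] -/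
@[simp] theorem wtLen_cons {x y z : ↥(boxDom (N0 ℓ Mh k P))} (h : (latGraphT (N0 ℓ Mh k P)).Adj x y)
    (p : (latGraphT (N0 ℓ Mh k P)).Walk y z) : wtLen D (SimpleGraph.Walk.cons h p) = stepWt D x y + wtLen D p := rfl

/-- weighted lengths are nonnegative. [cite: Balaban1985BackgroundPropagators, p.397 (weighted distance), bookkeeping] -/
theorem wtLen_nonneg {x y : ↥(boxDom (N0 ℓ Mh k P))} (p : (latGraphT (N0 ℓ Mh k P)).Walk x y) : 0 ≤ wtLen D p := by
  induction p with
  | nil => simp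
  | cons h p ih => rw [wtLen_cons]; exact add_nonneg (stepWt_pos D _ _).le ih

/-- weighted length is additive under concatenation. [cite: Balaban1985BackgroundPropagators, p.397 (weighted distance), bookkeeping] -/
theorem wtLen_append {x y z : ↥(boxDom (N0 ℓ Mh k P))} (p : (latGraphT (N0 ℓ Mh k P)).Walk x y)
    (q : (latGraphT (N0 ℓ Mh k P)).Walk y z) : wtLen D (p.append q) = wtLen D p + wtLen D q := by
  induction p with
  | nil => simp
  | cons h p ih => rw [SimpleGraph.Walk.cons_append, wtLen_cons, wtLen_cons, ih, add_assoc]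

/-- ★ **BELOW LEVEL `J` THE WEIGHTED LENGTH CONTROLS THE NUMBER OF STEPS**: if every site of the walk has level `≤ J` then
`|p| ≤ L^J · wtLen p`. [cite: Balaban1984PropagatorsII, p.231–232 (d versus (Lʲη)⁻¹|x − x′|), dictionary] -/
theorem length_le_mul_wtLen {J : ℕ} {x y : ↥(boxDom (N0 ℓ Mh k P))} (p : (latGraphT (N0 ℓ Mh k P)).Walk x y)
    (hJ : ∀ z ∈ p.support, D.lev z.1 ≤ J) :
    (p.length : ℝ) ≤ (((ℓ + 1) ^ J : ℕ) : ℝ) * wtLen D p := by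
  induction p with
  | nil => simp
  | @cons u v w h p ih =>
      rw [SimpleGraph.Walk.length_cons, Nat.cast_add, Nat.cast_one, wtLen_cons, mul_add]
      have hu : D.lev u.1 ≤ J := hJ u (by simp)
      have hv : D.lev v.1 ≤ J := hJ v (by simp)
      have hstep : (1 : ℝ) ≤ (((ℓ + 1) ^ J : ℕ) : ℝ) * stepWt D u v := by
        have hpos : (0 : ℝ) < (((ℓ + 1) ^ J : ℕ) : ℝ) := by positivity
        have := mul_le_mul_of_nonneg_left (stepWt_ge_of_le D hu hv) hpos.le
        rwa [mul_inv_cancel₀ hpos.ne'] at this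
      have ih' := ih (fun z hz => hJ z (by simp [hz]))
      linarith

end Weight

/-! ## §3 (2.2): adjacent levels differ by at most one; the distance to `Ω_{i+1}` and the band lemma -/

section Band

variable {ℓ Mh k R : ℕ} {P : Fin (d + 1) → ℕ} (D : TDomains d ℓ Mh k P R)

/-- `R·bigSide(j) ≥ 1` for `R, M_h ≥ 1`. [cite: Balaban1984PropagatorsII, (2.2) p.224, bookkeeping] -/
theorem one_le_R_mul_bigSide (hR : 1 ≤ R) (hMh : 1 ≤ Mh) (j : ℕ) : (1 : ℝ) ≤ ((R * bigSide ℓ Mh j : ℕ) : ℝ) := by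
  have h1 : 1 ≤ bigSide ℓ Mh j := by
    unfold bigSide; exact Nat.one_le_iff_ne_zero.2 (Nat.mul_ne_zero_iff.2 ⟨by omega, (Nat.pow_pos (by omega)).ne'⟩)
  exact_mod_cast Nat.one_le_iff_ne_zero.2 (Nat.mul_ne_zero_iff.2 ⟨by omega, by omega⟩)

/-- **(2.2) ⇒ NEIGHBOURING SITES DIFFER IN LEVEL BY AT MOST ONE**: `|z − z′|_T ≤ 1 ⇒ lev z′ ≤ lev z + 1` (a site of level
`≤ j − 1` and a site of level `≥ j + 1` are `> R·M·Lʲ` apart). [cite: Balaban1984PropagatorsII, (2.2) p.224] -/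
theorem lev_le_succ_of_torusSupNorm_le_one (hR : 1 ≤ R) (hMh : 1 ≤ Mh) {z z' : ↥(boxDom (N0 ℓ Mh k P))}
    (h : torusSupNorm (N0 ℓ Mh k P) (z.1 - z'.1) ≤ 1) : D.lev z'.1 ≤ D.lev z.1 + 1 := by
  by_contra hcon
  push Not at hcon
  have hsep := D.sepT (D.lev z.1 + 1) z.1 z.2 z'.1 z'.2 (Nat.lt_succ_self _) (by omega)
  have h1 := one_le_R_mul_bigSide (ℓ := ℓ) hR hMh (D.lev z.1 + 1)
  linarith

/-- the two-sided form on adjacent sites of the lattice graph: `lev z′ ≤ lev z + 1` and `lev z ≤ lev z′ + 1`.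
[cite: Balaban1984PropagatorsII, (2.2) p.224] -/
theorem lev_adj_le (hR : 1 ≤ R) (hMh : 1 ≤ Mh) (hP : ∀ μ, 1 ≤ P μ) {z z' : ↥(boxDom (N0 ℓ Mh k P))}
    (h : (latGraphT (N0 ℓ Mh k P)).Adj z z') : D.lev z'.1 ≤ D.lev z.1 + 1 ∧ D.lev z.1 ≤ D.lev z'.1 + 1 := by
  have hN := one_le_N0 (ℓ := ℓ) (k := k) hMh hP
  have h1 := torusSupNorm_le_one_of_adj hN h
  have h2 : torusSupNorm (N0 ℓ Mh k P) (z'.1 - z.1) ≤ 1 := by rwa [torusSupNorm_sub_comm hN]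
  exact ⟨lev_le_succ_of_torusSupNorm_le_one D hR hMh h1, lev_le_succ_of_torusSupNorm_le_one D hR hMh h2⟩

/-- **THE POTENTIAL OF THE BAND LEMMA**: the torus sup-distance from a site to `Ω_{i+1} = {lev ≥ i+1}` (an infimum over the
sites of level `≥ i+1`; `0` by convention if there is none). [cite: Balaban1984PropagatorsII, (2.2) p.224, dictionary] -/
def highDistT (i : ℕ) (w : ↥(boxDom (N0 ℓ Mh k P))) : ℝ :=
  sInf ((fun h : ↥(boxDom (N0 ℓ Mh k P)) => torusSupNorm (N0 ℓ Mh k P) (w.1 - h.1)) '' {h | i + 1 ≤ D.lev h.1})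

/-- the defining set of the potential is bounded below by `0`. [cite: Balaban1984PropagatorsII, (2.2) p.224, bookkeeping] -/
theorem highDistT_bddBelow (hMh : 1 ≤ Mh) (hP : ∀ μ, 1 ≤ P μ) (i : ℕ) (w : ↥(boxDom (N0 ℓ Mh k P))) :
    BddBelow ((fun h : ↥(boxDom (N0 ℓ Mh k P)) => torusSupNorm (N0 ℓ Mh k P) (w.1 - h.1)) '' {h | i + 1 ≤ D.lev h.1}) := by
  refine ⟨0, ?_⟩
  rintro _ ⟨h, _, rfl⟩
  exact torusSupNorm_nonneg (one_le_N0 hMh hP) _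

/-- the potential is nonnegative. [cite: Balaban1984PropagatorsII, (2.2) p.224, bookkeeping] -/
theorem highDistT_nonneg (hMh : 1 ≤ Mh) (hP : ∀ μ, 1 ≤ P μ) (i : ℕ) (w : ↥(boxDom (N0 ℓ Mh k P))) :
    0 ≤ highDistT D i w := by
  unfold highDistT
  rcases Set.eq_empty_or_nonempty
      ((fun h : ↥(boxDom (N0 ℓ Mh k P)) => torusSupNorm (N0 ℓ Mh k P) (w.1 - h.1)) '' {h | i + 1 ≤ D.lev h.1}) with he | hne
  · rw [he, Real.sInf_empty]
  · exact le_csInf hne (by rintro _ ⟨h, _, rfl⟩; exact torusSupNorm_nonneg (one_le_N0 hMh hP) _)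

/-- the potential vanishes on `Ω_{i+1}`. [cite: Balaban1984PropagatorsII, (2.2) p.224, dictionary] -/
theorem highDistT_eq_zero (hMh : 1 ≤ Mh) (hP : ∀ μ, 1 ≤ P μ) {i : ℕ} {w : ↥(boxDom (N0 ℓ Mh k P))}
    (hw : i + 1 ≤ D.lev w.1) : highDistT D i w = 0 := by
  refine le_antisymm ?_ (highDistT_nonneg D hMh hP i w)
  have hmem : (0 : ℝ) ∈ (fun h : ↥(boxDom (N0 ℓ Mh k P)) => torusSupNorm (N0 ℓ Mh k P) (w.1 - h.1)) ''
      {h | i + 1 ≤ D.lev h.1} := ⟨w, hw, torusSupNorm_sub_self (one_le_N0 hMh hP) _⟩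
  exact csInf_le (highDistT_bddBelow D hMh hP i w) hmem

/-- the potential is `1`-Lipschitz for the torus sup-distance: `T(w) ≤ T(w′) + |w − w′|_T`.
[cite: Balaban1984PropagatorsII, (2.54) p.233, dictionary] -/
theorem highDistT_sub_le (hMh : 1 ≤ Mh) (hP : ∀ μ, 1 ≤ P μ) {i : ℕ} (hne : ∃ h : ↥(boxDom (N0 ℓ Mh k P)), i + 1 ≤ D.lev h.1)
    (w w' : ↥(boxDom (N0 ℓ Mh k P))) :
    highDistT D i w ≤ highDistT D i w' + torusSupNorm (N0 ℓ Mh k P) (w.1 - w'.1) := by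
  have hN := one_le_N0 (ℓ := ℓ) (k := k) hMh hP
  obtain ⟨h₀, hh₀⟩ := hne
  have hne' : ((fun h : ↥(boxDom (N0 ℓ Mh k P)) => torusSupNorm (N0 ℓ Mh k P) (w'.1 - h.1)) ''
      {h | i + 1 ≤ D.lev h.1}).Nonempty := ⟨_, h₀, hh₀, rfl⟩
  rw [← sub_le_iff_le_add]
  refine le_csInf hne' ?_
  rintro _ ⟨h, hh, rfl⟩
  have h1 : highDistT D i w ≤ torusSupNorm (N0 ℓ Mh k P) (w.1 - h.1) :=
    csInf_le (highDistT_bddBelow D hMh hP i w) ⟨h, hh, rfl⟩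
  have h2 := torusSupNorm_sub_triangle hN w.1 w'.1 h.1
  linarith

/-- the potential changes by at most the torus distance: `|T(w) − T(w′)| ≤ |w − w′|_T`. [cite: Balaban1984PropagatorsII, (2.54) p.233, dictionary] -/
theorem abs_highDistT_sub_le (hMh : 1 ≤ Mh) (hP : ∀ μ, 1 ≤ P μ) {i : ℕ}
    (hne : ∃ h : ↥(boxDom (N0 ℓ Mh k P)), i + 1 ≤ D.lev h.1) (w w' : ↥(boxDom (N0 ℓ Mh k P))) :
    |highDistT D i w - highDistT D i w'| ≤ torusSupNorm (N0 ℓ Mh k P) (w.1 - w'.1) := by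
  rw [abs_sub_le_iff]
  constructor
  · linarith [highDistT_sub_le D hMh hP hne w w']
  · have := highDistT_sub_le D hMh hP hne w' w
    rw [torusSupNorm_sub_comm (one_le_N0 hMh hP)] at this
    linarith

/-- ★ **(2.2) AS A LOWER BOUND ON THE POTENTIAL**: a site of level `≤ i − 1` is at torus distance `> R·M_h·L^{i+1}` from
`Ω_{i+1}`, so `R·bigSide(i) ≤ T_i(w)`. [cite: Balaban1984PropagatorsII, (2.2) p.224] -/
theorem le_highDistT_of_lev_lt {i : ℕ} (hne : ∃ h : ↥(boxDom (N0 ℓ Mh k P)), i + 1 ≤ D.lev h.1)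
    {w : ↥(boxDom (N0 ℓ Mh k P))} (hw : D.lev w.1 < i) :
    ((R * bigSide ℓ Mh i : ℕ) : ℝ) ≤ highDistT D i w := by
  obtain ⟨h₀, hh₀⟩ := hne
  refine le_csInf ⟨_, h₀, hh₀, rfl⟩ ?_
  rintro _ ⟨h, hh, rfl⟩
  exact (D.sepT i w.1 w.2 h.1 h.2 hw hh).le

/-- **ONE STEP PAYS `L^{−(i+1)}` PER UNIT CHANGE OF THE POTENTIAL**: for adjacent sites,
`(L^{i+1})⁻¹·|T_i(w) − T_i(w′)| ≤ w(w, w′)` (if one end has level `≤ i` both have level `≤ i+1`; otherwise both are in `Ω_{i+1}`).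
[cite: Balaban1984PropagatorsII, (2.2) p.224; Agmon1982, Ch.1 (the weight), dictionary] -/
theorem stepWt_ge_highDistT (hR : 1 ≤ R) (hMh : 1 ≤ Mh) (hP : ∀ μ, 1 ≤ P μ) {i : ℕ}
    (hne : ∃ h : ↥(boxDom (N0 ℓ Mh k P)), i + 1 ≤ D.lev h.1) {w w' : ↥(boxDom (N0 ℓ Mh k P))}
    (h : (latGraphT (N0 ℓ Mh k P)).Adj w w') :
    ((((ℓ + 1) ^ (i + 1) : ℕ) : ℝ))⁻¹ * |highDistT D i w - highDistT D i w'| ≤ stepWt D w w' := by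
  have hN := one_le_N0 (ℓ := ℓ) (k := k) hMh hP
  by_cases hb : i + 1 ≤ D.lev w.1 ∧ i + 1 ≤ D.lev w'.1
  · rw [highDistT_eq_zero D hMh hP hb.1, highDistT_eq_zero D hMh hP hb.2, sub_zero, abs_zero, mul_zero]
    exact (stepWt_pos D _ _).le
  · -- one end has level `≤ i`, so both have level `≤ i + 1`
    obtain ⟨h1, h2⟩ := lev_adj_le D hR hMh hP h
    have hle : D.lev w.1 ≤ i + 1 ∧ D.lev w'.1 ≤ i + 1 := by
      rcases not_and_or.1 hb with hb | hb <;> exact ⟨by omega, by omega⟩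
    have hvar : |highDistT D i w - highDistT D i w'| ≤ 1 :=
      (abs_highDistT_sub_le D hMh hP hne w w').trans (torusSupNorm_le_one_of_adj hN h)
    have hpos : (0 : ℝ) < ((((ℓ + 1) ^ (i + 1) : ℕ) : ℝ))⁻¹ := by positivity
    calc ((((ℓ + 1) ^ (i + 1) : ℕ) : ℝ))⁻¹ * |highDistT D i w - highDistT D i w'|
        ≤ ((((ℓ + 1) ^ (i + 1) : ℕ) : ℝ))⁻¹ * 1 := mul_le_mul_of_nonneg_left hvar hpos.le
      _ ≤ stepWt D w w' := by rw [mul_one]; exact stepWt_ge_of_le D hle.1 hle.2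

/-- the variation of the potential along a walk is paid by its weighted length: for every site `a` on the walk,
`(L^{i+1})⁻¹·|T_i(start) − T_i(a)| ≤ wtLen p`. [cite: Agmon1982, Ch.1; Balaban1984PropagatorsII, (2.2) p.224, dictionary] -/
theorem highDistT_var_le_wtLen (hR : 1 ≤ R) (hMh : 1 ≤ Mh) (hP : ∀ μ, 1 ≤ P μ) {i : ℕ}
    (hne : ∃ h : ↥(boxDom (N0 ℓ Mh k P)), i + 1 ≤ D.lev h.1) {x y : ↥(boxDom (N0 ℓ Mh k P))}
    (p : (latGraphT (N0 ℓ Mh k P)).Walk x y) :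
    ∀ a ∈ p.support, ((((ℓ + 1) ^ (i + 1) : ℕ) : ℝ))⁻¹ * |highDistT D i x - highDistT D i a| ≤ wtLen D p := by
  induction p with
  | nil =>
      intro a ha
      rw [SimpleGraph.Walk.support_nil, List.mem_singleton] at ha
      subst ha
      simp
  | @cons u v w h p ih =>
      intro a ha
      rw [SimpleGraph.Walk.support_cons, List.mem_cons] at ha
      rw [wtLen_cons]
      rcases ha with rfl | ha
      · simp only [sub_self, abs_zero, mul_zero]
        exact add_nonneg (stepWt_pos D _ _).le (wtLen_nonneg D p)
      · have h1 := stepWt_ge_highDistT D hR hMh hP hne h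
        have h2 := ih a ha
        have htri : |highDistT D i u - highDistT D i a| ≤ |highDistT D i u - highDistT D i v| + |highDistT D i v - highDistT D i a| :=
          abs_sub_le _ _ _
        have hpos : (0 : ℝ) ≤ ((((ℓ + 1) ^ (i + 1) : ℕ) : ℝ))⁻¹ := by positivity
        calc ((((ℓ + 1) ^ (i + 1) : ℕ) : ℝ))⁻¹ * |highDistT D i u - highDistT D i a|
            ≤ ((((ℓ + 1) ^ (i + 1) : ℕ) : ℝ))⁻¹ * (|highDistT D i u - highDistT D i v| + |highDistT D i v - highDistT D i a|) :=
              mul_le_mul_of_nonneg_left htri hpos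
          _ ≤ stepWt D u v + wtLen D p := by rw [mul_add]; exact add_le_add h1 h2

/-- ★★ **THE BAND LEMMA**: a lattice walk meeting a site of level `≤ i − 1` and a site of level `≥ i + 1` has weighted length
`≥ R·M_h∕2` — crossing the band `Ω_i∖Ω_{i+1}` of (2.2) costs order `RM` in units of the local scale.
[cite: Balaban1984PropagatorsII, (2.2) p.224 («(Lʲη)⁻¹dist(Ω_j^c, Ω_{j+1}) > RM»); Agmon1982, Ch.1] -/
theorem wtLen_ge_of_spread (hR : 1 ≤ R) (hMh : 1 ≤ Mh) (hP : ∀ μ, 1 ≤ P μ) {i : ℕ} {x y : ↥(boxDom (N0 ℓ Mh k P))}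
    (p : (latGraphT (N0 ℓ Mh k P)).Walk x y) {lo hi : ↥(boxDom (N0 ℓ Mh k P))} (hlo : lo ∈ p.support) (hhi : hi ∈ p.support)
    (hlev_lo : D.lev lo.1 < i) (hlev_hi : i + 1 ≤ D.lev hi.1) :
    ((R * Mh : ℕ) : ℝ) / 2 ≤ wtLen D p := by
  have hne : ∃ h : ↥(boxDom (N0 ℓ Mh k P)), i + 1 ≤ D.lev h.1 := ⟨hi, hlev_hi⟩
  have hcpos : (0 : ℝ) < ((((ℓ + 1) ^ (i + 1) : ℕ) : ℝ))⁻¹ := by positivity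
  have h1 := highDistT_var_le_wtLen D hR hMh hP hne p lo hlo
  have h2 := highDistT_var_le_wtLen D hR hMh hP hne p hi hhi
  rw [highDistT_eq_zero D hMh hP hlev_hi, sub_zero] at h2
  have hlo' := le_highDistT_of_lev_lt D hne hlev_lo
  -- `T(lo) ≤ |T(x) − T(lo)| + |T(x)|`
  have htri : highDistT D i lo ≤ |highDistT D i x - highDistT D i lo| + |highDistT D i x| := by
    have a1 := le_abs_self (highDistT D i lo - highDistT D i x)
    have a2 := le_abs_self (highDistT D i x)
    rw [abs_sub_comm]
    linarith
  -- `(L^{i+1})⁻¹ · R · bigSide(i) = R · M_h`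
  have hkey : ((((ℓ + 1) ^ (i + 1) : ℕ) : ℝ))⁻¹ * ((R * bigSide ℓ Mh i : ℕ) : ℝ) = ((R * Mh : ℕ) : ℝ) := by
    have hpos : (0 : ℝ) < (((ℓ + 1) ^ (i + 1) : ℕ) : ℝ) := by positivity
    rw [bigSide]
    push_cast
    field_simp
  have hmain : ((((ℓ + 1) ^ (i + 1) : ℕ) : ℝ))⁻¹ * highDistT D i lo ≤ 2 * wtLen D p := by
    calc ((((ℓ + 1) ^ (i + 1) : ℕ) : ℝ))⁻¹ * highDistT D i lo
        ≤ ((((ℓ + 1) ^ (i + 1) : ℕ) : ℝ))⁻¹ * (|highDistT D i x - highDistT D i lo| + |highDistT D i x|) :=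
          mul_le_mul_of_nonneg_left htri hcpos.le
      _ = ((((ℓ + 1) ^ (i + 1) : ℕ) : ℝ))⁻¹ * |highDistT D i x - highDistT D i lo|
            + ((((ℓ + 1) ^ (i + 1) : ℕ) : ℝ))⁻¹ * |highDistT D i x| := mul_add _ _ _
      _ ≤ wtLen D p + wtLen D p := add_le_add h1 h2
      _ = 2 * wtLen D p := by ring
  have h3 : ((((ℓ + 1) ^ (i + 1) : ℕ) : ℝ))⁻¹ * ((R * bigSide ℓ Mh i : ℕ) : ℝ)
      ≤ ((((ℓ + 1) ^ (i + 1) : ℕ) : ℝ))⁻¹ * highDistT D i lo := mul_le_mul_of_nonneg_left hlo' hcpos.le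
  rw [hkey] at h3
  linarith

end Band

end

end Literature.MathematicalPhysics.QuantumFieldTheory.Balaban1983to89.B6TorusSiteWalks
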